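import Summits.QuantumFields.YangMills.Theorems.AllWindowsColdBoxBoxHighLineCum3TriangleBound

/-!
# Bridge: the centred Gaussian part of a plaquette cost IS the centred colour-diagonal rank-one form of the L2 kit —
# `E₀[a_b a_{b'}] = S_{bb'}` and `linCurvSq_q(a) − E₀[linCurvSq_q] = Σ_{bb'} L^q_{bb'}·(a_b a_{b'} − S_{bb'})` (U5-BLOCKERS §2, lift L2)

Width seat `ym-line-sfw-p2-w3` (g41), cell ym-idea-1; helper-grade glue.  The odd-part and quartic-vertex size lemmas (✓`…WickPairCubicColdBox`,
✓`…QuarticVertexColdBox`) are stated for the centred form `Σ_{bb'} L_{bb'}(a_ba_{b'} − S_{bb'})` with `L = [κ=κ']·Λ_q⊗Λ_q` and the chart propagator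
`S = (2β)⁻¹·[κ=κ']·(hodgeQ H)⁻¹`; this file identifies it with `linCurvSq H q a − gaussAvg β H (linCurvSq H q)` (the centred observable `L̃_q` of ASSEMBLY-S5/U5):
* `gaussAvg_coord_mul_coord` — `gaussAvg β H (a_b·a_{b'}) = S_{bb'}` (✓`EdgeChartGaussian.integral_coord_mul_coord_mul_exp_colourForm`);
* `gaussAvg_linCurvSq` — `gaussAvg β H (linCurvSq H q) = Σ_{bb'} L_{bb'}·S_{bb'}` (✓`QuadFluct.integral_quadForm_mul_exp`);
* ★ `linCurvSq_sub_gaussAvg_eq_centredForm` — the identity above.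

Tree only; no definitions; standard axioms.  HONEST LABEL: glue for the RECORDED lift L2 of the NEXT rung U5 (⟨stmt-QuantumFields-24336⟩, UNSTAFFED); ⟨24004⟩ ⟨24336⟩
remain OPEN; route AllWindowsColdBox is DRAFT; no crux, rung or summit is proved; **the Yang–Mills mass gap is NOT proved by this file; no summit is proved by a line.**
-/

set_option autoImplicit false

noncomputable section

open MeasureTheory Matrix Finset
open scoped Kronecker
open Literature.MathematicalPhysics.QuantumFieldTheory (Plaq)

namespace Summit.QuantumFields.YangMills.Theorems.AllWindowsColdBoxBoxHighLine

namespace Cum3Triangle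

variable {H : ℕ}

/-- The cold-box partition constant is positive. -/
theorem partitionZ_pos (H : ℕ) {β : ℝ} (hβ : 0 < β) :
    0 < Real.sqrt (Real.pi / β) ^ Fintype.card (LandauFree H × Fin 3) / Real.sqrt (hodgeQ H ⊗ₖ (1 : Matrix (Fin 3) (Fin 3) ℝ)).det := by
  have h := EdgeChartGaussian.integral_exp_neg_colourForm_pos (hodgeQ H) (hodgeQ_posDef H) hβ
  rwa [EdgeChartGaussian.integral_exp_neg_colourForm (hodgeQ H) (hodgeQ_posDef H) hβ] at h

/-- **Two-point function of the chart coordinates**: `gaussAvg β H (a_b·a_{b'}) = (2β)⁻¹·[κ_b=κ_{b'}]·(hodgeQ H)⁻¹_{e_b e_{b'}}`. -/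
theorem gaussAvg_coord_mul_coord (H : ℕ) {β : ℝ} (hβ : 0 < β) (b b' : LandauFree H × Fin 3) :
    gaussAvg β H (fun a => a b.1 b.2 * a b'.1 b'.2) = (2 * β)⁻¹ * (if b.2 = b'.2 then (hodgeQ H)⁻¹ b.1 b'.1 else 0) := by
  unfold gaussAvg
  simp_rw [EdgeChartGaussian.gaussWeight_eq]
  rw [EdgeChartGaussian.integral_coord_mul_coord_mul_exp_colourForm (hodgeQ H) (hodgeQ_posDef H) hβ b b',
    EdgeChartGaussian.integral_exp_neg_colourForm (hodgeQ H) (hodgeQ_posDef H) hβ, mul_div_cancel_left₀ _ (partitionZ_pos H hβ).ne']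

/-- **Gaussian mean of the plaquette form**: `gaussAvg β H (linCurvSq H q) = Σ_{bb'} L_{bb'}·S_{bb'}`. -/
theorem gaussAvg_linCurvSq (H : ℕ) {β : ℝ} (hβ : 0 < β) (q : Plaq 4) (S L : LandauFree H × Fin 3 → LandauFree H × Fin 3 → ℝ)
    (hS : ∀ i j, S i j = (2 * β)⁻¹ * if i.2 = j.2 then (hodgeQ H)⁻¹ i.1 j.1 else 0)
    (hL : ∀ i j, L i j = if i.2 = j.2 then landauCoeff H q i.1 * landauCoeff H q j.1 else 0) :
    gaussAvg β H (linCurvSq H q) = ∑ b, ∑ b', L b b' * S b b' := by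
  set A : Matrix (LandauFree H × Fin 3) (LandauFree H × Fin 3) ℝ :=
    Matrix.of fun i j => if i.2 = j.2 then landauCoeff H q i.1 * landauCoeff H q j.1 else 0 with hAdef
  set P : Matrix (LandauFree H × Fin 3) (LandauFree H × Fin 3) ℝ := hodgeQ H ⊗ₖ (1 : Matrix (Fin 3) (Fin 3) ℝ) with hPdef
  have hP : P.PosDef := GaussianChartWick.posDef_kronecker_one _ (hodgeQ_posDef H)
  have hLq : linCurvSq H q = quadVal A := funext fun a => linCurvSq_eq_quadVal q a
  have h1 := QuadFluct.integral_quadVal_pow_mul_gaussWeight β H A 1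
  simp only [pow_one] at h1
  unfold gaussAvg
  rw [hLq, h1, QuadFluct.integral_gaussWeight H hβ, QuadFluct.integral_quadForm_mul_exp P hP hβ A,
    mul_div_cancel_left₀ _ (partitionZ_pos H hβ).ne']
  simp only [QuadFluct.single_S_row, Matrix.mul_apply, Matrix.transpose_apply, Finset.mul_sum]
  refine Finset.sum_congr rfl fun b _ => Finset.sum_congr rfl fun b' _ => ?_
  rw [hS, hL, hPdef, EdgeChartGaussian.kronecker_one_inv_apply (hodgeQ H) (hodgeQ_posDef H).det_pos.ne']
  simp only [hAdef, Matrix.of_apply]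
  ring

/-- ★ **The centred plaquette form is the centred rank-one form of the L2 kit**:
`linCurvSq H q a − gaussAvg β H (linCurvSq H q) = Σ_{bb'} L_{bb'}·(a_b a_{b'} − S_{bb'})`. -/
theorem linCurvSq_sub_gaussAvg_eq_centredForm (H : ℕ) {β : ℝ} (hβ : 0 < β) (q : Plaq 4)
    (S L : LandauFree H × Fin 3 → LandauFree H × Fin 3 → ℝ)
    (hS : ∀ i j, S i j = (2 * β)⁻¹ * if i.2 = j.2 then (hodgeQ H)⁻¹ i.1 j.1 else 0)
    (hL : ∀ i j, L i j = if i.2 = j.2 then landauCoeff H q i.1 * landauCoeff H q j.1 else 0) (a : LandauFree H → E3) :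
    linCurvSq H q a - gaussAvg β H (linCurvSq H q) = ∑ b, ∑ b', L b b' * (a b.1 b.2 * a b'.1 b'.2 - S b b') := by
  rw [gaussAvg_linCurvSq H hβ q S L hS hL, linCurvSq_eq_quadVal q a, quadVal, GaussianChartWick.quadForm_legs_eq]
  simp only [mul_sub, Finset.sum_sub_distrib, Matrix.of_apply, hL, flat]

end Cum3Triangle

end Summit.QuantumFields.YangMills.Theorems.AllWindowsColdBoxBoxHighLine

end
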